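import Literature.NumberTheory.Transcendental.DiazZeroFreeBall
import Literature.NumberTheory.Transcendental.PhilipponCriterion
import Literature.NumberTheory.Transcendental.DiazLadderProofs
import HarnessLib

/-!
# Diaz 1989, Théorème 1 from Philippon's criterion and the zero lemma (§II-4-3, the conclusion)

Topic `Literature/NumberTheory/Transcendental`. Assembly of the proof of the
named fact `Literature.NumberTheory.Transcendental.Diaz1989_thm1` (`DiazMain.lean`; G. Diaz,
J. Number Theory 31 (1989), Théorème 1: `trdeg_ℚ ℚ(v_k, e^{u_hv_k}) ≥ [(mn+m)/(m+n)]` under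
(HT1)) from the two deep tools it rests on, both vendored as named facts:

* `Philippon1986_mainCriterion` (`PhilipponCriterion.lean`; Philippon 1986, Thm 2.11, the
  transcendence-degree form of Diaz, p. 16), and
* `Diaz1989_zeroLemma` (`DiazZeroLemma.lean`; Diaz, pp. 11–12, from Philippon's zero estimate),

on top of the proved steps `DiazConstruction` (§II-2), `IntegerTaylor`, `DiazPoints`,
`InterpolationBound`, `DiazEstimates` (§II-3-1, 3-2), `DiazParams`, `DiazSmallness` (§II-4-1, 4-2),
`DiazZeroFree`, `DiazZeroFreeBall` (§II-3-4). Main results: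

* `Diaz1989_thm1_of_criterion : Philippon1986_mainCriterion → Diaz1989_zeroLemma → Diaz1989_thm1`;
* `diaz_1989_of_criterion : Philippon1986_mainCriterion → Diaz1989_zeroLemma → diaz_1989` (the
  Gelfond–Diaz ladder `trdeg ℚ(α^β, …, α^{β^{d-1}}) ≥ [(d+1)/2]`, through `diaz_1989_of_thm1` of
  `DiazLadderProofs.lean`), and the same for `Diaz1989_gridX`, `Diaz1989_cor1`,
  `Literature.NumberTheory.Transcendental.Diaz1989`.

So the trust base of `diaz_1989` is now exactly {Philippon's criterion, the zero lemma}.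

## The argument (Diaz 1989, §II-4-3 "Conclusion", p. 16), and the choices made here

For a real `X` let `D, L, M, M₁ = a₂M, ρ` be the parameters of §II-4-1 (`DiazParams.lean`),
`Φ₀ = X^{m+n}(log X)^{1/(n+1)}`, `Ψ₀ = X^{m(n+1)} log X` (`ρ = 16(n+1)Ψ₀`). For all large `X`
(`GoodX`, `eventually_goodX`): Siegel's step yields unknowns `p ≠ 0` (`coeffs`) with `Q_μ = 0`
for `|μ| < M`; the family `𝓕_X = {Q_{μj} ; |μ| < M₁, j ∈ J_X}` where `J_X` is the set of minimal
indices `j(θ̃)` at the points `θ̃` of the ball `𝓑_ρ = {max|θ̃ᵢ - θᵢ| ≤ e^{-ρ}}` (`GoodIdx`; indexed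
by the finite type `FamIdx`, `famPoly`) satisfies: every member is small at `θ`,
`|Q(θ)| ≤ exp(-c_SΨ₀)` (`eventually_small`: the smallness holds for `j` minimal at *any* point of
the ball); `deg Q, log L(Q) ≤ c_δΦ₀` (`eventually_deg_len`); no common zero in `𝓑_ρ` and some
member `≠ 0` at `θ ∈ 𝓑_ρ` (`eventually_zeroFree`: at `θ̃` take `j = j(θ̃) ∈ J_X`). With an integer
shift `N₁` beyond the threshold, the criterion is applied at the point `θ = (v_k, e^{u_hv_k})`
(variables transported to `Fin (m+nm)`, `varEquiv`; `ℓ¹`-length and values are invariant,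
`l1_rename_of_injective`, `aeval_rename`) with `σ(N) = δ(N) = c_δΦ₀(N+N₁)`, `R(N) = ρ(N+N₁)`,
`S(N) = c_SΨ₀(N+N₁)`, `k + 1 = [(mn+m)/(m+n)]` and the ideals `I_N = (𝓕_{N+N₁})`: the functions
are `≥ 1`, non-decreasing, `σ + δ → ∞`; `S/((σ+δ)δ^k)` is the scale
`X^{m(n+1)-(m+n)(k+1)}(log X)^{1-(k+1)/(n+1)}` with non-negative exponents (`ratio_eq`), hence
non-decreasing; and the main inequality `S(N)^{k+2} ≥ C(σ+δ)(N+1)δ(N+1)^k(S(N)^{k+1} + R(N+1)^{k+1})`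
reduces (`main_ineq_at`, values at `X+1` being `≤ 2^{a+b}` times those at `X`) to
`KΦ₀^{k+1} ≤ Ψ₀`, true for large `X` because `(m+n)(k+1) ≤ m(n+1)` and, in case of equality,
`(k+1)/(n+1) < 1` (`eventually_Phi0_pow_le_Psi0` — the fractional power of `log X` in `D` and `L`
is what earns the `+m` in `[(mn+m)/(m+n)]`). The criterion gives `trdeg ℚ(θ) ≥ k + 1`.

Everything in this file is proved (no new named facts); `#print axioms` of the main theorem is
`{propext, Classical.choice, Quot.sound}`.

## References

* G. Diaz, *Grands degrés de transcendance pour des familles d'exponentielles*, J. Number Theory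
  31 (1989), 1–23, Théorème 1 (pp. 1–2), §II-4-3 (p. 16), Corollaires 1, 2 (p. 3).
* P. Philippon, *Critères pour l'indépendance algébrique*, Publ. Math. IHÉS 64 (1986), 5–52,
  Thm 2.11.
* Yu. V. Nesterenko, P. Philippon (eds.), *Introduction to Algebraic Independence Theory*,
  LNM 1752, Springer 2001, Ch. 14, Thm 2.7, Cor. 2.8.
-/

noncomputable section

open Filter Real Finset Literature.NumberTheory.Transcendental.Asymp MvPolynomial
  Literature.NumberTheory.Transcendental.Chudnovsky Literature.NumberTheory.Transcendental.Taylor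

namespace Literature.NumberTheory.Transcendental

namespace DiazThm1

variable {m n : ℕ}

/-! ### Scales: monotonicity in `X`, shift `X ↦ X + 1`, quotients -/

/-- Scales with nonnegative exponents are non-decreasing on `[1, ∞)`. [folklore] -/
theorem scale_mono {a b X Y : ℝ} (ha : 0 ≤ a) (hb : 0 ≤ b) (hX : 1 ≤ X) (hXY : X ≤ Y) :
    scale a b X ≤ scale a b Y := by
  unfold scale
  have hlogX : 0 ≤ Real.log X := Real.log_nonneg hX
  have hlog : Real.log X ≤ Real.log Y := Real.log_le_log (by linarith) hXY
  exact mul_le_mul (Real.rpow_le_rpow (by linarith) hXY ha) (Real.rpow_le_rpow hlogX hlog hb)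
    (Real.rpow_nonneg hlogX _) (Real.rpow_nonneg (by linarith) _)

/-- `X^a(log X)^b` at `X + 1` is at most `2^{a+b}` times its value at `X` (`X ≥ 2`, `a, b ≥ 0`).
[folklore] -/
theorem scale_add_one_le {a b X : ℝ} (ha : 0 ≤ a) (hb : 0 ≤ b) (hX : 2 ≤ X) :
    scale a b (X + 1) ≤ 2 ^ (a + b) * scale a b X := by
  unfold scale
  have hX0 : 0 < X := by linarith
  have hlog1 : 0 ≤ Real.log X := Real.log_nonneg (by linarith)
  have h1 : (X + 1) ^ a ≤ (2 : ℝ) ^ a * X ^ a := by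
    rw [← Real.mul_rpow (by norm_num) hX0.le]
    exact Real.rpow_le_rpow (by linarith) (by linarith) ha
  have h2 : Real.log (X + 1) ≤ 2 * Real.log X := by
    have : X + 1 ≤ X * X := by nlinarith
    calc Real.log (X + 1) ≤ Real.log (X * X) := Real.log_le_log (by linarith) this
      _ = 2 * Real.log X := by rw [Real.log_mul hX0.ne' hX0.ne']; ring
  have h3 : Real.log (X + 1) ^ b ≤ (2 : ℝ) ^ b * Real.log X ^ b := by
    rw [← Real.mul_rpow (by norm_num) hlog1]
    exact Real.rpow_le_rpow (Real.log_nonneg (by linarith)) h2 hb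
  calc (X + 1) ^ a * Real.log (X + 1) ^ b ≤ ((2 : ℝ) ^ a * X ^ a) * ((2 : ℝ) ^ b * Real.log X ^ b) :=
        mul_le_mul h1 h3 (Real.rpow_nonneg (Real.log_nonneg (by linarith)) _) (by positivity)
    _ = 2 ^ (a + b) * (X ^ a * Real.log X ^ b) := by
        rw [Real.rpow_add (by norm_num : (0 : ℝ) < 2)]; ring

/-- Quotient of scales (`X > 1`). [folklore] -/
theorem scale_div_scale {a b a' b' X : ℝ} (hX : 1 < X) :
    scale a b X / scale a' b' X = scale (a - a') (b - b') X := by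
  unfold scale
  rw [Real.rpow_sub (by linarith), Real.rpow_sub (Real.log_pos hX)]
  have h1 : 0 < X ^ a' := Real.rpow_pos_of_pos (by linarith) _
  have h2 : 0 < Real.log X ^ b' := Real.rpow_pos_of_pos (Real.log_pos hX) _
  field_simp

/-- `Φ₀`, `Ψ₀` are non-decreasing on `[1, ∞)`. [folklore] -/
theorem Phi0_mono {X Y : ℝ} (hX : 1 ≤ X) (hXY : X ≤ Y) : Phi0 m n X ≤ Phi0 m n Y :=
  scale_mono (by positivity) (by positivity) hX hXY

/-- `Ψ₀` is non-decreasing on `[1, ∞)`. [folklore] -/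
theorem Psi0_mono {X Y : ℝ} (hX : 1 ≤ X) (hXY : X ≤ Y) : Psi0 m n X ≤ Psi0 m n Y :=
  scale_mono (by positivity) zero_le_one hX hXY

/-- `Φ₀ ≥ X ≥ 1` and `Ψ₀ ≥ 1` for `X ≥ e` (`m ≥ 1`). [folklore] -/
theorem X_le_Phi0 (hm : 1 ≤ m) {X : ℝ} (hX : Real.exp 1 ≤ X) : X ≤ Phi0 m n X := by
  have h := scale_le_scale (a := 1) (b := 0) (a' := (m : ℝ) + n) (b' := 1 / (n + 1 : ℝ))
    (by have : (1 : ℝ) ≤ m := by exact_mod_cast hm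
        have : (0 : ℝ) ≤ n := Nat.cast_nonneg n
        linarith) (by positivity) hX
  rwa [scale_one_zero] at h

/-- **The domination `K Φ₀^{k+1} ≤ Ψ₀` eventually**, for `(m+n)(k+1) ≤ m(n+1)` and `k < n`: the
powers of `X` satisfy `(m+n)(k+1) ≤ m(n+1)`, and in case of equality the powers of `log X` are
`(k+1)/(n+1) < 1` (this is where the exponent `1/(n+1)` of `log X` in `D, L` earns the `+m` of
`[(mn+m)/(m+n)]`). [cite: Diaz1989, §II-4-3 p. 16] -/
theorem eventually_Phi0_pow_le_Psi0 {k : ℕ} (hk : (m + n) * (k + 1) ≤ m * (n + 1)) (hkn : k < n)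
    (K : ℝ) : ∀ᶠ X in atTop, K * Phi0 m n X ^ (k + 1) ≤ Psi0 m n X := by
  have hn0 : (0 : ℝ) ≤ n := Nat.cast_nonneg n
  rcases hk.lt_or_eq with hlt | heq
  · have hlt' : ((m : ℝ) + n) * ((k : ℝ) + 1) < (m : ℝ) * (n + 1) := by exact_mod_cast hlt
    filter_upwards [eventually_mul_scale_le_of_lt hlt' (1 / (n + 1 : ℝ) * ((k : ℝ) + 1)) 1 K,
      eventually_ge_atTop (1 : ℝ)] with X hX hX1
    rw [Phi0, scale_pow hX1, Psi0]
    push_cast at hX ⊢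
    exact hX
  · have heq' : ((m : ℝ) + n) * ((k : ℝ) + 1) = (m : ℝ) * (n + 1) := by exact_mod_cast heq
    have hb : 1 / (n + 1 : ℝ) * ((k : ℝ) + 1) < 1 := by
      rw [one_div_mul_eq_div, div_lt_one (by positivity)]
      have : (k : ℝ) + 1 ≤ n := by exact_mod_cast hkn
      linarith
    filter_upwards [eventually_mul_scale_le_of_lt_right ((m : ℝ) * (n + 1)) hb K,
      eventually_ge_atTop (1 : ℝ)] with X hX hX1
    rw [Phi0, scale_pow hX1, Psi0]
    push_cast
    rw [heq']
    exact hX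

/-! ### Siegel's coefficients and the family of polynomials at `X` -/

section Family

variable (u : Fin n → ℂ) (v : Fin m → ℂ)

open Classical in
/-- The unknowns `p` of Siegel's step at `X` (`exists_coeffs`: not all zero, `|p| ≤ H`,
`Q_μ = 0` for `|μ| < M`), when they exist; `0` otherwise. [cite: Diaz1989, §II-2 p. 5] -/
def coeffs (m n : ℕ) (X : ℝ) : Unk m n (Dp m n X) (Lp m n X) (Mp n X) → ℤ :=
  if h : ∃ p : Unk m n (Dp m n X) (Lp m n X) (Mp n X) → ℤ, p ≠ 0 ∧
      (∀ w, |(p w : ℝ)| ≤ Hgt m n X) ∧ ∀ μ : Fin m → ℕ, (∀ k, μ k < Mp n X) → Q p μ = 0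
  then h.choose else 0

/-- Under (𝒞1) the unknowns exist, so `coeffs` has the three properties of Siegel's step.
[cite: Diaz1989, §II-2 p. 5] -/
theorem coeffs_spec (hm : 1 ≤ m) {X : ℝ} (hD : 1 ≤ Dp m n X) (hL : 1 ≤ Lp m n X)
    (hM : 1 ≤ Mp n X) (hC1 : 2 ^ (m + n * m + 1) * Mp n X ^ m ≤ Dp m n X * Lp m n X ^ n) :
    coeffs m n X ≠ 0 ∧ (∀ w, |(coeffs m n X w : ℝ)| ≤ Hgt m n X) ∧
      ∀ μ : Fin m → ℕ, (∀ k, μ k < Mp n X) → Q (coeffs m n X) μ = 0 := by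
  classical
  have h : ∃ p : Unk m n (Dp m n X) (Lp m n X) (Mp n X) → ℤ, p ≠ 0 ∧
      (∀ w, |(p w : ℝ)| ≤ Hgt m n X) ∧ ∀ μ : Fin m → ℕ, (∀ k, μ k < Mp n X) → Q p μ = 0 := by
    obtain ⟨p, hp0, hpb, hpv⟩ := exists_coeffs (n := n) hm hD hL hM hC1
    exact ⟨p, hp0, hpb, hpv⟩
  rw [coeffs, dif_pos h]
  exact h.choose_spec

/-- The ball `𝓑_ρ`: `max |θ̃ᵢ - θᵢ| ≤ e^{-ρ}`. [cite: Diaz1989, §II-3-2 p. 7] -/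
def InBall (X : ℝ) (θ' : Var m n → ℂ) : Prop :=
  ∀ i, ‖theta u v i - θ' i‖ ≤ Real.exp (-rho m n X)

/-- `θ ∈ 𝓑_ρ`. [folklore] -/
theorem inBall_theta (X : ℝ) : InBall u v X (theta u v) := fun i => by
  simp [le_of_lt (Real.exp_pos _)]

/-- The good indices at `X`: minimal indices (for `coeffs`) at points of the ball `𝓑_ρ`.
[cite: Diaz1989, §II-3-1 p. 6 (j(θ̃))] -/
def GoodIdx (X : ℝ) (j : Var m n →₀ ℕ) : Prop :=
  ∃ θ' : Var m n → ℂ, InBall u v X θ' ∧ IsMinIdx (coeffs m n X) θ' j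

open Classical in
/-- A minimal index at `θ` itself (when `coeffs ≠ 0`), else `0`. [cite: Diaz1989, §II-3-1 p. 6] -/
def j0 (X : ℝ) : Var m n →₀ ℕ :=
  if h : ∃ j, IsMinIdx (coeffs m n X) (theta u v) j then h.choose else 0

/-- `j0` is a minimal index at `θ` as soon as `coeffs ≠ 0`. [folklore] -/
theorem isMinIdx_j0 {X : ℝ} (h : coeffs m n X ≠ 0) : IsMinIdx (coeffs m n X) (theta u v) (j0 u v X) := by
  classical
  have hex : ∃ j, IsMinIdx (coeffs m n X) (theta u v) j := exists_isMinIdx h _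
  rw [j0, dif_pos hex]
  exact hex.choose_spec

/-- The degree bound `T₀` at `X`. [cite: Diaz1989, §II-3-2 (2) p. 8] -/
abbrev TX (m n : ℕ) (X : ℝ) : ℕ := T0 m n (Dp m n X) (Lp m n X) (Mp n X)

/-- The index type of the family at `X`: `μ ∈ ℕ^m(M₁)` and a candidate multi-index with entries
`≤ T₀`. [folklore] -/
abbrev FamIdx (m n : ℕ) (X : ℝ) : Type :=
  (Fin m → Fin (M1p m n X)) × (Var m n → Fin (TX m n X + 1))

/-- The multi-index encoded by the second component of a `FamIdx`. [folklore] -/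
def toJ {X : ℝ} (e : Var m n → Fin (TX m n X + 1)) : Var m n →₀ ℕ :=
  Finsupp.equivFunOnFinite.symm fun x => (e x : ℕ)

/-- `toJ e x = e x`. [folklore] -/
@[simp] theorem toJ_apply {X : ℝ} (e : Var m n → Fin (TX m n X + 1)) (x : Var m n) :
    toJ e x = (e x : ℕ) := rfl

open Classical in
/-- The multi-index used for the index `e`: `toJ e` if it is good, else `j0`. [folklore] -/
def jOf (X : ℝ) (e : Var m n → Fin (TX m n X + 1)) : Var m n →₀ ℕ :=
  if GoodIdx u v X (toJ e) then toJ e else j0 u v X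

/-- **The family `𝓕_X = {Q_{μj} ; |μ| < M₁, j a minimal index at a point of 𝓑_ρ}`** fed to
Philippon's criterion, indexed by `FamIdx` (indices whose multi-index is not good are sent to
`Q_{μ j₀}`). [cite: Diaz1989, §II-4-3 p. 16] -/
def famPoly (X : ℝ) (i : FamIdx m n X) : MvPolynomial (Var m n) ℤ :=
  Qj (coeffs m n X) (fun k => (i.1 k : ℕ)) (jOf u v X i.2)

/-- The `μ` of an index has `|μ| < M₁`. [folklore] -/
theorem mu_lt {X : ℝ} (i : FamIdx m n X) (k : Fin m) : (fun k => (i.1 k : ℕ)) k < M1p m n X :=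
  (i.1 k).isLt

/-- If `coeffs ≠ 0`, the multi-index of every member of the family is good. [folklore] -/
theorem goodIdx_jOf {X : ℝ} (h : coeffs m n X ≠ 0) (e : Var m n → Fin (TX m n X + 1)) :
    GoodIdx u v X (jOf u v X e) := by
  classical
  unfold jOf
  split_ifs with hg
  · exact hg
  · exact ⟨theta u v, inBall_theta u v X, isMinIdx_j0 u v h⟩

/-- A minimal index has all its entries `≤ T₀` (a Taylor coefficient of index longer than
`deg P_{dλ} ≤ T₀` vanishes). [folklore] -/
theorem le_TX_of_isMinIdx {X : ℝ} {p : Unk m n (Dp m n X) (Lp m n X) (Mp n X) → ℤ}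
    {θ' : Var m n → ℂ} {j : Var m n →₀ ℕ} (hj : IsMinIdx p θ' j) (x : Var m n) :
    j x ≤ TX m n X := by
  classical
  obtain ⟨⟨a, ha⟩, -⟩ := hj
  have hne : Pj p a j ≠ 0 := by
    intro h0; apply ha; rw [h0, map_zero]
  have hdeg : Finsupp.degree j ≤ (Pdl p a).totalDegree := by
    by_contra hlt
    exact hne (taylorCoeff_eq_zero_of_lt j (Pdl p a) (not_le.mp hlt))
  exact (Finsupp.le_degree x j).trans (hdeg.trans (totalDegree_Pdl_le p a))

/-- Every good index is the multi-index of some member of the family. [folklore] -/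
theorem exists_jOf_eq {X : ℝ} {j : Var m n →₀ ℕ} (hj : GoodIdx u v X j) :
    ∃ e : Var m n → Fin (TX m n X + 1), jOf u v X e = j := by
  classical
  obtain ⟨θ', hθ', hmin⟩ := hj
  refine ⟨fun x => ⟨j x, Nat.lt_succ_of_le (le_TX_of_isMinIdx hmin x)⟩, ?_⟩
  have he : toJ (X := X) (fun x => ⟨j x, Nat.lt_succ_of_le (le_TX_of_isMinIdx hmin x)⟩) = j := by
    ext x; rfl
  rw [jOf, he, if_pos ⟨θ', hθ', hmin⟩]

end Family


/-! ### The eventual facts at `X`, bundled, and the properties of the family -/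

section GoodX

variable {m' : ℕ} (u : Fin n → ℂ) (v : Fin (m' + 1) → ℂ)

/-- The facts, valid for all large `X`, that the assembly uses at the level `X` (`m = m'+1`):
`X ≥ 3`; `D, L, M ≥ 2` and (𝒞1) (Siegel's step applies); the smallness `|Q_{μj}(θ)| ≤ e^{-c_SΨ₀}`
(`eventually_small`); the degree and length bounds (`eventually_deg_len`); no common zero in the
ball (`eventually_zeroFree`); and `c_SΨ₀ ≥ 1`. [folklore] -/
structure GoodX (X : ℝ) : Prop where
  three_le : 3 ≤ X
  two_le_D : 2 ≤ Dp (m' + 1) n X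
  two_le_L : 2 ≤ Lp (m' + 1) n X
  two_le_M : 2 ≤ Mp n X
  C1 : 2 ^ ((m' + 1) + n * (m' + 1) + 1) * Mp n X ^ (m' + 1) ≤ Dp (m' + 1) n X * Lp (m' + 1) n X ^ n
  small : ∀ (p : Unk (m' + 1) n (Dp (m' + 1) n X) (Lp (m' + 1) n X) (Mp n X) → ℤ),
      (∀ w, |(p w : ℝ)| ≤ Hgt (m' + 1) n X) →
      (∀ μ' : Fin (m' + 1) → ℕ, (∀ k, μ' k < Mp n X) → Q p μ' = 0) →
      ∀ θ' : Var (m' + 1) n → ℂ, (∀ i, ‖theta u v i - θ' i‖ ≤ Real.exp (-rho (m' + 1) n X)) →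
      ∀ j : Var (m' + 1) n →₀ ℕ, IsMinIdx p θ' j →
      ∀ μ : Fin (m' + 1) → ℕ, (∀ k, μ k < M1p (m' + 1) n X) →
        ‖MvPolynomial.aeval (theta u v) (Qj p μ j)‖ ≤
          Real.exp (-(cS (m' + 1) n * Psi0 (m' + 1) n X))
  degLen : ∀ (p : Unk (m' + 1) n (Dp (m' + 1) n X) (Lp (m' + 1) n X) (Mp n X) → ℤ),
      (∀ w, |(p w : ℝ)| ≤ Hgt (m' + 1) n X) → ∀ μ : Fin (m' + 1) → ℕ,
      (∀ k, μ k < M1p (m' + 1) n X) → ∀ j : Var (m' + 1) n →₀ ℕ,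
        ((Qj p μ j).totalDegree : ℝ) ≤ cdelta (m' + 1) n * Phi0 (m' + 1) n X ∧
        Real.log (l1 (Qj p μ j)) ≤ cdelta (m' + 1) n * Phi0 (m' + 1) n X
  zeroFree : ∀ (M : ℕ) (p : Unk (m' + 1) n (Dp (m' + 1) n X) (Lp (m' + 1) n X) M → ℤ)
      (θ' : Var (m' + 1) n → ℂ), (∀ i, ‖theta u v i - θ' i‖ ≤ Real.exp (-rho (m' + 1) n X)) →
      ∀ j : Var (m' + 1) n →₀ ℕ, IsMinIdx p θ' j →
        ∃ μ : Fin (m' + 1) → ℕ, (∀ k, μ k < M1p (m' + 1) n X) ∧ aeval θ' (Qj p μ j) ≠ 0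
  S_ge : 1 ≤ cS (m' + 1) n * Psi0 (m' + 1) n X

/-- **All large `X` are good.** [cite: Diaz1989, §II-4-2 p. 15] -/
theorem eventually_goodX (hm' : 1 ≤ m') (hn : 1 ≤ n) {c : ℝ} (hc : 0 < c)
    (hZc : ZeroLemmaAt n hn c) (hu : LinearIndependent ℚ u) (hv : LinearIndependent ℚ v)
    {ηa ηb : ℝ} (hA : Diaz1989.MeasureA u ηa) (hB : Diaz1989.MeasureB v ηb)
    (hηa : 0 ≤ ηa) (hηa' : (2 * ((m' + 1 - 1 : ℕ) : ℝ) + (n + 1)) * ηa < (m' + 1 : ℕ) * (n + 1))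
    (hηb : 0 ≤ ηb) (hηb' : (((m' + 1 - 1 : ℕ) : ℝ) + 2 * (n + 1)) * ηb ≤ (m' + 1 : ℕ) * (n + 1))
    (hηb'' : ηb < n + 1) :
    ∀ᶠ X in atTop, GoodX u v X := by
  have hm : 1 ≤ m' + 1 := by omega
  have hm2 : 2 ≤ m' + 1 := by omega
  have hS : ∀ᶠ X in atTop, 1 ≤ cS (m' + 1) n * Psi0 (m' + 1) n X := by
    have hcS := cS_pos (m := m' + 1) (n := n) hm2 hn
    filter_upwards [eventually_const_le_scale (a := ((m' + 1 : ℕ) : ℝ) * (n + 1)) (b := 1)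
      (Or.inl (by positivity)) (1 / cS (m' + 1) n)] with X hX
    rw [Psi0]
    have := mul_le_mul_of_nonneg_left hX hcS.le
    rw [mul_one_div_cancel hcS.ne'] at this
    push_cast at this ⊢
    exact this
  filter_upwards [eventually_ge_atTop (3 : ℝ), eventually_D_ge (m := m' + 1) (n := n) (by omega),
    eventually_L_ge (m := m' + 1) (n := n), eventually_M_ge (n := n), eventually_C1 (n := n) hm hn,
    eventually_small hm' hn u v hB, eventually_deg_len (m := m' + 1) (n := n) hm,
    eventually_zeroFree hn hm2 hc hZc hu hv hA hB hηa hηa' hηb hηb' hηb'', hS]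
    with X h3 hD hL hM hC1 hsm hdl hzf hS1
  exact ⟨h3, hD.2, hL.2, hM.2, hC1, hsm, hdl, hzf, hS1⟩

variable {u v}

/-- At a good `X`, Siegel's coefficients are non-trivial, bounded by `H`, and kill the `Q_μ`,
`|μ| < M`. [cite: Diaz1989, §II-2 p. 5] -/
theorem GoodX.coeffs {X : ℝ} (hG : GoodX u v X) :
    coeffs (m' + 1) n X ≠ 0 ∧ (∀ w, |(coeffs (m' + 1) n X w : ℝ)| ≤ Hgt (m' + 1) n X) ∧
      ∀ μ : Fin (m' + 1) → ℕ, (∀ k, μ k < Mp n X) → Q (coeffs (m' + 1) n X) μ = 0 :=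
  coeffs_spec (by omega) (le_trans (by norm_num) hG.two_le_D) (le_trans (by norm_num) hG.two_le_L)
    (le_trans (by norm_num) hG.two_le_M) hG.C1

/-- **All members of the family are small at `θ`**: `|Q(θ)| ≤ exp(-c_S Ψ₀)`.
[cite: Diaz1989, §II-4-2 (c) p. 15] -/
theorem GoodX.small_famPoly {X : ℝ} (hG : GoodX u v X) (i : FamIdx (m' + 1) n X) :
    ‖aeval (theta u v) (famPoly u v X i)‖ ≤ Real.exp (-(cS (m' + 1) n * Psi0 (m' + 1) n X)) := by
  obtain ⟨h0, hb, hv0⟩ := hG.coeffs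
  obtain ⟨θ', hθ', hmin⟩ := goodIdx_jOf u v h0 i.2
  exact hG.small _ hb hv0 θ' hθ' _ hmin _ (mu_lt i)

/-- Degrees and lengths of the members of the family: `deg Q ≤ c_δ Φ₀`, `log L(Q) ≤ c_δ Φ₀`.
[cite: Diaz1989, §II-4-2 (b) p. 15] -/
theorem GoodX.degLen_famPoly {X : ℝ} (hG : GoodX u v X) (i : FamIdx (m' + 1) n X) :
    ((famPoly u v X i).totalDegree : ℝ) ≤ cdelta (m' + 1) n * Phi0 (m' + 1) n X ∧
      Real.log (l1 (famPoly u v X i)) ≤ cdelta (m' + 1) n * Phi0 (m' + 1) n X := by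
  obtain ⟨-, hb, -⟩ := hG.coeffs
  exact hG.degLen _ hb _ (mu_lt i) _

/-- **No common zero of the family in the ball `𝓑_ρ`.** [cite: Diaz1989, §II-3-4 p. 14] -/
theorem GoodX.exists_ne_zero {X : ℝ} (hG : GoodX u v X) {θ' : Var (m' + 1) n → ℂ}
    (hθ' : InBall u v X θ') : ∃ i : FamIdx (m' + 1) n X, aeval θ' (famPoly u v X i) ≠ 0 := by
  obtain ⟨h0, -, -⟩ := hG.coeffs
  obtain ⟨j, hj⟩ := exists_isMinIdx h0 θ'
  obtain ⟨μ, hμ, hne⟩ := hG.zeroFree _ _ θ' hθ' j hj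
  obtain ⟨e, he⟩ := exists_jOf_eq u v ⟨θ', hθ', hj⟩
  refine ⟨(fun k => ⟨μ k, hμ k⟩, e), ?_⟩
  simpa [famPoly, he] using hne

/-- Some member of the family does not vanish at `θ`. [cite: Diaz1989, §II-4-3 p. 16] -/
theorem GoodX.exists_ne_zero_theta {X : ℝ} (hG : GoodX u v X) :
    ∃ i : FamIdx (m' + 1) n X, aeval (theta u v) (famPoly u v X i) ≠ 0 :=
  hG.exists_ne_zero (inBall_theta u v X)

end GoodX


/-! ### Transport of the variables `Y = (Y_k, Y_hk)` to `Fin (m + nm)` -/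

/-- `Var m n ≃ Fin (m + nm)` (the criterion is stated for polynomials in `X₁, …, X_q`). [folklore] -/
def varEquiv (m n : ℕ) : Var m n ≃ Fin (m + n * m) :=
  (Equiv.sumCongr (Equiv.refl (Fin m)) finProdFinEquiv).trans finSumFinEquiv

/-- The `ℓ¹`-norm is invariant under an injective renaming of the variables. [folklore] -/
theorem l1_rename_of_injective {σ τ : Type*} {f : σ → τ} (hf : Function.Injective f)
    (P : MvPolynomial σ ℤ) : l1 (rename f P) = l1 P := by
  classical
  show wnorm _ _ = wnorm _ _
  unfold wnorm
  rw [support_rename_of_injective hf,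
    Finset.sum_image fun a _ b _ h => Finsupp.mapDomain_injective hf h]
  refine Finset.sum_congr rfl fun α _ => ?_
  rw [coeff_rename_mapDomain f hf]

/-! ### The functions `σ = δ`, `R`, `S` of the criterion -/

/-- `σ(N) = δ(N) = c_δ Φ₀(N + N₁)` (degrees and logarithmic lengths). [cite: Diaz1989, §II-4-3 p. 16] -/
def sigF (m n N₁ : ℕ) (N : ℕ) : ℝ := cdelta m n * Phi0 m n ((N : ℝ) + N₁)

/-- `R(N) = ρ(N + N₁)` (radius `e^{-R}` of the ball). [cite: Diaz1989, §II-4-3 p. 16] -/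
def RF (m n N₁ : ℕ) (N : ℕ) : ℝ := rho m n ((N : ℝ) + N₁)

/-- `S(N) = c_S Ψ₀(N + N₁)` (smallness). [cite: Diaz1989, §II-4-3 p. 16] -/
def SF (m n N₁ : ℕ) (N : ℕ) : ℝ := cS m n * Psi0 m n ((N : ℝ) + N₁)

section Growth

variable {N₁ : ℕ} (hN₁ : 3 ≤ N₁)
include hN₁

/-- `X_N = N + N₁ ≥ 3`. [folklore] -/
theorem three_le_X (N : ℕ) : (3 : ℝ) ≤ (N : ℝ) + N₁ := by
  have h1 : (3 : ℝ) ≤ N₁ := by exact_mod_cast hN₁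
  have h2 : (0 : ℝ) ≤ N := Nat.cast_nonneg N
  linarith

/-- `X_N = N + N₁ ≥ e`. [folklore] -/
theorem exp_one_le_X (N : ℕ) : Real.exp 1 ≤ (N : ℝ) + N₁ := by
  have h1 := three_le_X hN₁ N
  have h2 := Real.exp_one_lt_d9
  norm_num at h2
  linarith

/-- `σ` is non-decreasing. [folklore] -/
theorem sigF_mono : Monotone (sigF m n N₁) := by
  intro a b hab
  unfold sigF
  refine mul_le_mul_of_nonneg_left (Phi0_mono (by linarith [three_le_X hN₁ a])
    (by simpa using (Nat.cast_le (α := ℝ)).mpr hab)) (le_trans zero_le_one one_le_cdelta)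

/-- `R` is non-decreasing. [folklore] -/
theorem RF_mono : Monotone (RF m n N₁) := by
  intro a b hab
  unfold RF rho
  have hn : (0 : ℝ) ≤ 16 * (n + 1) := by positivity
  exact mul_le_mul_of_nonneg_left (Psi0_mono (m := m) (n := n) (by linarith [three_le_X hN₁ a])
    (by simpa using (Nat.cast_le (α := ℝ)).mpr hab)) hn

/-- `S` is non-decreasing. [folklore] -/
theorem SF_mono : Monotone (SF m n N₁) := by
  intro a b hab
  unfold SF
  exact mul_le_mul_of_nonneg_left (Psi0_mono (by linarith [three_le_X hN₁ a])
    (by simpa using (Nat.cast_le (α := ℝ)).mpr hab)) cS_nonneg_le.1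

/-- `σ ≥ X_N ≥ 1` (`m ≥ 1`). [folklore] -/
theorem X_le_sigF (hm : 1 ≤ m) (N : ℕ) : (N : ℝ) + N₁ ≤ sigF m n N₁ N := by
  unfold sigF
  have hX := three_le_X hN₁ N
  have hXe : Real.exp 1 ≤ (N : ℝ) + N₁ := exp_one_le_X hN₁ N
  have h1 := X_le_Phi0 (n := n) hm hXe
  have h2 : 0 ≤ Phi0 m n ((N : ℝ) + N₁) := by linarith
  calc (N : ℝ) + N₁ ≤ Phi0 m n ((N : ℝ) + N₁) := h1
    _ = 1 * Phi0 m n ((N : ℝ) + N₁) := (one_mul _).symm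
    _ ≤ _ := mul_le_mul_of_nonneg_right one_le_cdelta h2

/-- `σ ≥ 1`. [folklore] -/
theorem one_le_sigF (hm : 1 ≤ m) (N : ℕ) : 1 ≤ sigF m n N₁ N :=
  le_trans (by linarith [three_le_X hN₁ N]) (X_le_sigF hN₁ hm N)

/-- `R ≥ 1`. [folklore] -/
theorem one_le_RF (N : ℕ) : 1 ≤ RF m n N₁ N := by
  unfold RF rho
  have hX := three_le_X hN₁ N
  have hXe : Real.exp 1 ≤ (N : ℝ) + N₁ := exp_one_le_X hN₁ N
  have h1 : 1 ≤ scale (m * (n + 1)) 1 ((N : ℝ) + N₁) := one_le_scale (by positivity) zero_le_one hXe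
  have hn : (0 : ℝ) ≤ n := Nat.cast_nonneg n
  nlinarith

/-- `σ + δ → ∞`. [folklore] -/
theorem tendsto_sigF (hm : 1 ≤ m) : Tendsto (fun N => sigF m n N₁ N + sigF m n N₁ N) atTop atTop := by
  refine tendsto_atTop_mono (fun N => ?_) tendsto_natCast_atTop_atTop
  have h1 := X_le_sigF (n := n) hN₁ hm N
  have h2 : (0 : ℝ) ≤ N₁ := Nat.cast_nonneg N₁
  linarith

/-- **The quotient `S/((σ+δ)δ^k)` is a scale with nonnegative exponents**, hence non-decreasing,
when `(m+n)(k+1) ≤ m(n+1)` and `k < n`. [folklore] -/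
theorem ratio_eq {k : ℕ} (N : ℕ) :
    SF m n N₁ N / ((sigF m n N₁ N + sigF m n N₁ N) * sigF m n N₁ N ^ k) =
      cS m n / (2 * cdelta m n ^ (k + 1)) *
        scale ((m : ℝ) * (n + 1) - ((m : ℝ) + n) * ((k : ℝ) + 1))
          (1 - 1 / (n + 1 : ℝ) * ((k : ℝ) + 1)) ((N : ℝ) + N₁) := by
  set X : ℝ := (N : ℝ) + N₁ with hXdef
  have hX1 : 1 < X := by linarith [three_le_X hN₁ N]
  have hcd : (0 : ℝ) < cdelta m n := lt_of_lt_of_le one_pos one_le_cdelta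
  have hΦ : 0 < Phi0 m n X := scale_pos hX1
  unfold SF sigF
  rw [← hXdef]
  have e1 : (cdelta m n * Phi0 m n X + cdelta m n * Phi0 m n X) * (cdelta m n * Phi0 m n X) ^ k =
      2 * cdelta m n ^ (k + 1) * Phi0 m n X ^ (k + 1) := by ring
  rw [e1, Phi0, scale_pow hX1.le, Psi0]
  have hs : 0 < scale (((m : ℝ) + n) * ((k + 1 : ℕ) : ℝ)) (1 / (n + 1 : ℝ) * ((k + 1 : ℕ) : ℝ)) X :=
    scale_pos hX1
  rw [← scale_div_scale hX1]
  push_cast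
  field_simp

/-- The quotient `S/((σ+δ)δ^k)` is non-decreasing. [folklore] -/
theorem ratio_mono {k : ℕ} (hk : (m + n) * (k + 1) ≤ m * (n + 1)) (hkn : k < n) :
    Monotone fun N => SF m n N₁ N / ((sigF m n N₁ N + sigF m n N₁ N) * sigF m n N₁ N ^ k) := by
  intro a b hab
  simp only [ratio_eq hN₁]
  have hcd : (0 : ℝ) < cdelta m n := lt_of_lt_of_le one_pos one_le_cdelta
  have hK : 0 ≤ cS m n / (2 * cdelta m n ^ (k + 1)) := div_nonneg cS_nonneg_le.1 (by positivity)
  refine mul_le_mul_of_nonneg_left (scale_mono ?_ ?_ (by linarith [three_le_X hN₁ a])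
    (by simpa using (Nat.cast_le (α := ℝ)).mpr hab)) hK
  · have : ((m : ℝ) + n) * ((k : ℝ) + 1) ≤ (m : ℝ) * (n + 1) := by exact_mod_cast hk
    linarith
  · have hn0 : (0 : ℝ) < n + 1 := by positivity
    have : (k : ℝ) + 1 ≤ n := by exact_mod_cast hkn
    rw [one_div_mul_eq_div, sub_nonneg, div_le_one hn0]
    linarith

end Growth


/-! ### The main inequality `S^{k+2} ≥ C(σ+δ)δ^k(S^{k+1} + R^{k+1})` of the criterion -/

/-- The constant `K` with `C(σ+δ)(N+1)δ(N+1)^k(S(N)^{k+1} + R(N+1)^{k+1}) ≤ K Φ₀^{k+1}Ψ₀^{k+1}`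
(at `X = N + N₁`). [folklore] -/
def Kmain (m n k : ℕ) (C : ℝ) : ℝ :=
  2 * C * cdelta m n ^ (k + 1) * ((2 : ℝ) ^ (((m : ℝ) + n) + 1 / (n + 1 : ℝ))) ^ (k + 1) *
    (cS m n ^ (k + 1) + (16 * ((n : ℝ) + 1) * (2 : ℝ) ^ ((m : ℝ) * (n + 1) + 1)) ^ (k + 1))

/-- **The main inequality of the criterion at `X`**, from the domination
`K Φ₀(X)^{k+1} ≤ c_S^{k+2} Ψ₀(X)` (the values at `X + 1` are at most `2^{a+b}` times those at `X`).
[cite: Diaz1989, §II-4-3 p. 16] -/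
theorem main_ineq_at {k : ℕ} {C X : ℝ} (hC : 1 ≤ C) (hX : 2 ≤ X)
    (hE : Kmain m n k C * Phi0 m n X ^ (k + 1) ≤ cS m n ^ (k + 2) * Psi0 m n X) :
    C * (cdelta m n * Phi0 m n (X + 1) + cdelta m n * Phi0 m n (X + 1)) *
        (cdelta m n * Phi0 m n (X + 1)) ^ k *
        ((cS m n * Psi0 m n X) ^ (k + 1) + rho m n (X + 1) ^ (k + 1)) ≤
      (cS m n * Psi0 m n X) ^ (k + 2) := by
  have hX1 : 1 ≤ X := by linarith
  have hn0 : (0 : ℝ) ≤ n := Nat.cast_nonneg n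
  set g : ℝ := (2 : ℝ) ^ (((m : ℝ) + n) + 1 / (n + 1 : ℝ)) with hg
  set g' : ℝ := (2 : ℝ) ^ ((m : ℝ) * (n + 1) + 1) with hg'
  have hΦ0 : 0 ≤ Phi0 m n X := scale_nonneg hX1
  have hΨ0 : 0 ≤ Psi0 m n X := scale_nonneg hX1
  have hΦ1 : Phi0 m n (X + 1) ≤ g * Phi0 m n X :=
    scale_add_one_le (by positivity) (by positivity) hX
  have hΨ1 : Psi0 m n (X + 1) ≤ g' * Psi0 m n X := scale_add_one_le (by positivity) zero_le_one hX
  have hΦ10 : 0 ≤ Phi0 m n (X + 1) := scale_nonneg (by linarith)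
  have hΨ10 : 0 ≤ Psi0 m n (X + 1) := scale_nonneg (by linarith)
  have hcd : 0 ≤ cdelta m n := le_trans zero_le_one one_le_cdelta
  have hcS : 0 ≤ cS m n := cS_nonneg_le.1
  have hC0 : 0 ≤ C := le_trans zero_le_one hC
  set c16 : ℝ := 16 * ((n : ℝ) + 1) with hc16
  have hc0 : 0 ≤ c16 := by positivity
  have hρ : rho m n (X + 1) = c16 * Psi0 m n (X + 1) := rfl
  calc C * (cdelta m n * Phi0 m n (X + 1) + cdelta m n * Phi0 m n (X + 1)) *
        (cdelta m n * Phi0 m n (X + 1)) ^ k *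
        ((cS m n * Psi0 m n X) ^ (k + 1) + rho m n (X + 1) ^ (k + 1))
      = 2 * C * cdelta m n ^ (k + 1) * (Phi0 m n (X + 1) ^ (k + 1) *
          ((cS m n * Psi0 m n X) ^ (k + 1) + c16 ^ (k + 1) * Psi0 m n (X + 1) ^ (k + 1))) := by
        rw [hρ, mul_pow c16 (Psi0 m n (X + 1)) (k + 1), mul_pow (cdelta m n) (Phi0 m n (X + 1)) k]
        ring
    _ ≤ 2 * C * cdelta m n ^ (k + 1) * ((g * Phi0 m n X) ^ (k + 1) *
          ((cS m n * Psi0 m n X) ^ (k + 1) + c16 ^ (k + 1) * (g' * Psi0 m n X) ^ (k + 1))) := by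
        gcongr
    _ = Kmain m n k C * Phi0 m n X ^ (k + 1) * Psi0 m n X ^ (k + 1) := by
        rw [Kmain, ← hg, ← hg', ← hc16, mul_pow g, mul_pow g', mul_pow c16, mul_pow (cS m n)]
        ring
    _ ≤ cS m n ^ (k + 2) * Psi0 m n X * Psi0 m n X ^ (k + 1) :=
        mul_le_mul_of_nonneg_right hE (pow_nonneg hΨ0 _)
    _ = (cS m n * Psi0 m n X) ^ (k + 2) := by rw [mul_pow]; ring

/-! ### Assembly: Diaz's Théorème 1 from Philippon's criterion and the zero lemma -/

/-- Transcendence degrees of fields generated by equal sets agree (transport along `S = S'`,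
stated separately because the set occurs inside a type). [folklore] -/
theorem trdeg_adjoin_congr {S S' : Set ℂ} (h : S = S') :
    Algebra.trdeg ℚ ↥(IntermediateField.adjoin ℚ S) =
      Algebra.trdeg ℚ ↥(IntermediateField.adjoin ℚ S') := by
  subst h; rfl

/-- The exponent bookkeeping: with `t = [(mn+m)/(m+n)]` and `k = t - 1` one has `k + 1 = t ≥ 1`,
`(m+n)(k+1) ≤ m(n+1)` and `k < n` (`m, n ≥ 1`). [folklore] -/
theorem exponent_facts (hm : 1 ≤ m) (hn : 1 ≤ n) :
    (m * n + m) / (m + n) - 1 + 1 = (m * n + m) / (m + n) ∧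
    (m + n) * ((m * n + m) / (m + n) - 1 + 1) ≤ m * (n + 1) ∧
    (m * n + m) / (m + n) - 1 < n := by
  have hpos : 0 < m + n := by omega
  have ht1 : 1 ≤ (m * n + m) / (m + n) := by
    rw [Nat.le_div_iff_mul_le hpos, one_mul]
    nlinarith
  have e : (m * n + m) / (m + n) - 1 + 1 = (m * n + m) / (m + n) := by omega
  refine ⟨e, ?_, ?_⟩
  · rw [e, mul_comm]
    calc (m * n + m) / (m + n) * (m + n) ≤ m * n + m := Nat.div_mul_le_self _ _
      _ = m * (n + 1) := by ring
  · have hlt : (m * n + m) / (m + n) < n + 1 := by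
      rw [Nat.div_lt_iff_lt_mul hpos]
      nlinarith
    omega

end DiazThm1

open DiazThm1

/-- **Diaz 1989, Théorème 1, from Philippon's criterion (Thm 2.11) and the zero lemma** (§II-4-3,
p. 16, "Conclusion": apply the criterion at `θ = (v_k, e^{u_hv_k})` with `σ = δ ≍ X^{m+n}(log X)^{1/(n+1)}`,
`R = ρ`, `S ≍ X^{m(n+1)} log X` and the ideals `I_N` generated by the `Q_{μj}`, `|μ| < M₁`, `j` a
minimal index at a point of the ball `𝓑_ρ`: they are small at `θ` (§II-3-2, §II-4-2), not all
zero at `θ` and without common zero in `𝓑_ρ` (§II-3-4), and the growth conditions hold with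
`k + 1 = [(mn+m)/(m+n)]` because `(m+n)(k+1) ≤ m(n+1)` and `(k+1)/(n+1) < 1`).
[cite: Diaz1989, Théorème 1, pp. 1–2; proof §II, pp. 4–16] -/
theorem Diaz1989_thm1_of_criterion (hC : Philippon1986_mainCriterion) (hZ : Diaz1989_zeroLemma) :
    Diaz1989_thm1 := by
  intro n m u v hu hv hA hB hn hm
  obtain ⟨m', rfl⟩ : ∃ m', m = m' + 1 := ⟨m - 1, by omega⟩
  have hm' : 1 ≤ m' := by omega
  have hm1 : 1 ≤ m' + 1 := by omega
  obtain ⟨c, hc, hZc⟩ := exists_zeroLemmaAt hZ n hn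
  -- Diaz's exponents qualify for (𝒞9)
  have hn0 : (0 : ℝ) ≤ n := Nat.cast_nonneg n
  have hn1 : (1 : ℝ) ≤ n := by exact_mod_cast hn
  have hm'1 : (1 : ℝ) ≤ m' := by exact_mod_cast hm'
  have hcast : ((m' + 1 - 1 : ℕ) : ℝ) = m' := by simp
  have hmc : ((m' + 1 : ℕ) : ℝ) = (m' : ℝ) + 1 := by push_cast; ring
  have hηa : (0 : ℝ) ≤ ((m' + 1 : ℕ) * (n + 1) : ℝ) / (2 * (m' + 1 : ℕ) + n) := by positivity
  have hηa' : (2 * ((m' + 1 - 1 : ℕ) : ℝ) + (n + 1)) * (((m' + 1 : ℕ) * (n + 1) : ℝ) /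
      (2 * (m' + 1 : ℕ) + n)) < (m' + 1 : ℕ) * (n + 1) := by
    rw [hcast, hmc]
    have hd : (0 : ℝ) < 2 * ((m' : ℝ) + 1) + n := by positivity
    rw [← mul_div_assoc, div_lt_iff₀ hd]
    nlinarith
  have hηb : (0 : ℝ) ≤ ((m' + 1 : ℕ) * (n + 1) : ℝ) / ((m' + 1 : ℕ) + 2 * n + 1) := by positivity
  have hηb' : (((m' + 1 - 1 : ℕ) : ℝ) + 2 * (n + 1)) * (((m' + 1 : ℕ) * (n + 1) : ℝ) /
      ((m' + 1 : ℕ) + 2 * n + 1)) ≤ (m' + 1 : ℕ) * (n + 1) := by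
    rw [hcast, hmc]
    have hd : (0 : ℝ) < ((m' : ℝ) + 1) + 2 * n + 1 := by positivity
    rw [← mul_div_assoc, div_le_iff₀ hd]
    nlinarith
  have hηb'' : ((m' + 1 : ℕ) * (n + 1) : ℝ) / ((m' + 1 : ℕ) + 2 * n + 1) < n + 1 := by
    rw [hmc]
    have hd : (0 : ℝ) < ((m' : ℝ) + 1) + 2 * n + 1 := by positivity
    rw [div_lt_iff₀ hd]
    nlinarith
  -- the exponent `k + 1 = [(mn+m)/(m+n)]`
  obtain ⟨hk1, hk, hkn⟩ := exponent_facts (n := n) hm1 hn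
  set k : ℕ := ((m' + 1) * n + (m' + 1)) / ((m' + 1) + n) - 1 with hkdef
  -- the transported point `θ ∈ ℂ^q`
  set eV := varEquiv (m' + 1) n with heV
  set θq : Fin ((m' + 1) + n * (m' + 1)) → ℂ := theta u v ∘ eV.symm with hθq
  have hkq : k ≤ (m' + 1) + n * (m' + 1) := by
    have : n ≤ n * (m' + 1) := Nat.le_mul_of_pos_right n (by omega)
    omega
  obtain ⟨C, hC1, hcrit⟩ := hC _ k θq hkq
  -- a threshold `X₀` beyond which every `X` is good and the domination of the main inequality holds
  have hcS := cS_pos (m := m' + 1) (n := n) (by omega) hn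
  have hev := (eventually_goodX u v hm' hn hc hZc hu hv hA hB hηa hηa' hηb hηb' hηb'').and
    (eventually_Phi0_pow_le_Psi0 (m := m' + 1) (n := n) hk hkn
      (Kmain (m' + 1) n k C / cS (m' + 1) n ^ (k + 2)))
  obtain ⟨X₀, hX₀⟩ := Filter.eventually_atTop.mp hev
  set N₁ : ℕ := ⌈max X₀ 0⌉₊ + 3 with hN₁def
  have hN₁3 : 3 ≤ N₁ := by omega
  have hXN : ∀ N : ℕ, X₀ ≤ (N : ℝ) + N₁ := fun N => by
    have h1 : X₀ ≤ ⌈max X₀ 0⌉₊ := (le_max_left _ _).trans (Nat.le_ceil _)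
    have h2 : (N₁ : ℝ) = (⌈max X₀ 0⌉₊ : ℝ) + 3 := by rw [hN₁def]; push_cast; ring
    have h3 : (0 : ℝ) ≤ N := Nat.cast_nonneg N
    linarith
  have hG : ∀ N : ℕ, GoodX u v ((N : ℝ) + N₁) := fun N => (hX₀ _ (hXN N)).1
  have hE : ∀ N : ℕ, Kmain (m' + 1) n k C * Phi0 (m' + 1) n ((N : ℝ) + N₁) ^ (k + 1) ≤
      cS (m' + 1) n ^ (k + 2) * Psi0 (m' + 1) n ((N : ℝ) + N₁) := fun N => by
    have h := (hX₀ _ (hXN N)).2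
    have hpos : 0 < cS (m' + 1) n ^ (k + 2) := pow_pos hcS _
    have := mul_le_mul_of_nonneg_left h hpos.le
    rwa [← mul_assoc, mul_div_cancel₀ _ hpos.ne'] at this
  -- the criterion
  have main := hcrit (sigF (m' + 1) n N₁) (sigF (m' + 1) n N₁) (RF (m' + 1) n N₁) (SF (m' + 1) n N₁)
    (sigF_mono hN₁3) (sigF_mono hN₁3) (RF_mono hN₁3) (SF_mono hN₁3)
    (one_le_sigF hN₁3 hm1) (one_le_sigF hN₁3 hm1) (one_le_RF hN₁3) (fun N => (hG N).S_ge)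
    (tendsto_sigF hN₁3 hm1) (ratio_mono hN₁3 hk hkn)
    (fun N => by
      have h := main_ineq_at (m := m' + 1) (n := n) (k := k) hC1
        (by linarith [three_le_X hN₁3 N]) (hE N)
      simp only [sigF, RF, SF, Nat.cast_succ]
      convert h using 4 <;> ring_nf)
    0 (fun N => Fintype.card (FamIdx (m' + 1) n ((N : ℝ) + N₁)))
    (fun N i => rename eV (famPoly u v ((N : ℝ) + N₁) ((Fintype.equivFin _).symm i)))
    (fun N _ => by
      have hGN := hG N
      have hθ : θq ∘ eV = theta u v := by
        funext x; simp [hθq]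
      refine ⟨?_, ?_, ?_, ?_, ?_⟩
      · -- no common zero in the ball of radius `e^{-R(N)} = e^{-ρ}`
        refine Set.finite_empty.subset ?_
        rintro z ⟨hz, hz0⟩
        have hball : InBall u v ((N : ℝ) + N₁) (z ∘ eV) := fun x => by
          have := hz (eV x)
          rw [norm_sub_rev]
          simpa [hθq, RF] using this
        obtain ⟨i, hi⟩ := hGN.exists_ne_zero hball
        apply hi
        have := hz0 (Fintype.equivFin _ i)
        rwa [aeval_rename, Equiv.symm_apply_apply] at this
      · intro j
        refine le_trans ?_ (hGN.degLen_famPoly ((Fintype.equivFin _).symm j)).1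
        exact_mod_cast totalDegree_rename_le _ _
      · intro j
        rw [l1_rename_of_injective eV.injective]
        exact (hGN.degLen_famPoly ((Fintype.equivFin _).symm j)).2
      · obtain ⟨i, hi⟩ := hGN.exists_ne_zero_theta
        refine ⟨Fintype.equivFin _ i, ?_⟩
        rwa [aeval_rename, hθ, Equiv.symm_apply_apply]
      · intro j
        rw [aeval_rename, hθ]
        exact hGN.small_famPoly ((Fintype.equivFin _).symm j))
  -- conclusion: `ℚ(θ) = ℚ(v, e^{uv})` and `k + 1 = [(mn+m)/(m+n)]`
  have hr : Set.range θq = Set.range v ∪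
      Set.range fun p : Fin n × Fin (m' + 1) => Complex.exp (u p.1 * v p.2) := by
    rw [hθq, eV.symm.surjective.range_comp]
    exact Set.Sum.elim_range _ _
  have hfin : (((((m' + 1) * n + (m' + 1)) / ((m' + 1) + n) : ℕ)) : Cardinal) ≤
      Algebra.trdeg ℚ ↥(IntermediateField.adjoin ℚ (Set.range θq)) := by
    rw [← hk1]; exact main
  exact hfin.trans_eq (trdeg_adjoin_congr hr)


/-- **The Gelfond–Diaz ladder from Philippon's criterion and the zero lemma**:
`Philippon1986_mainCriterion → Diaz1989_zeroLemma → diaz_1989`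
(`trdeg_ℚ ℚ(α^β, …, α^{β^{d-1}}) ≥ [(d+1)/2]`), through Diaz's Théorème 1
(`Diaz1989_thm1_of_criterion`), the Technical Hypothesis by Liouville's inequality
(`Diaz1989_gridX_of_thm1`) and Gelfond–Schneider for `d = 2` (`diaz_1989_of_thm1`). What remains for
`diaz_1989_holds` is exactly the two named tools `Philippon1986_mainCriterion` (Philippon 1986,
Thm 2.11) and `Diaz1989_zeroLemma` (Diaz 1989, pp. 11–12, from Philippon's zero estimate).
[cite: Diaz1989, Corollaire 2, p. 3] -/
theorem diaz_1989_of_criterion (hC : Philippon1986_mainCriterion) (hZ : Diaz1989_zeroLemma) :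
    diaz_1989 :=
  diaz_1989_of_thm1 (Diaz1989_thm1_of_criterion hC hZ)

/-- LNM 1752, Ch. 14, Thm 2.7 (bound for `t₁`, under (T.H.)) from the two named tools.
[cite: NesterenkoPhilippon2001, Ch. 14 Thm 2.7 (t₁), p. 248] -/
theorem Diaz1989_gridX_of_criterion (hC : Philippon1986_mainCriterion) (hZ : Diaz1989_zeroLemma) :
    Diaz1989_gridX :=
  Diaz1989_gridX_of_thm1 (Diaz1989_thm1_of_criterion hC hZ)

/-- Diaz 1989, Corollaire 1 (the ladder for an arbitrary base `a = e^l`) from the two named tools.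
[cite: Diaz1989, Corollaire 1, p. 3] -/
theorem Diaz1989_cor1_of_criterion (hC : Philippon1986_mainCriterion) (hZ : Diaz1989_zeroLemma) :
    Diaz1989_cor1 :=
  Diaz1989_cor1_of_thm1 (Diaz1989_thm1_of_criterion hC hZ)

/-- The duplicate vendoring `Literature.NumberTheory.Transcendental.Diaz1989` (`GelfondDiaz.lean`)
from the two named tools. [cite: Diaz1989, Corollaire 2, p. 3] -/
theorem periods_Diaz1989_of_criterion (hC : Philippon1986_mainCriterion)
    (hZ : Diaz1989_zeroLemma) : Literature.NumberTheory.Transcendental.Diaz1989 :=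
  periods_Diaz1989_of_diaz_1989 (diaz_1989_of_criterion hC hZ)

end Literature.NumberTheory.Transcendental

end
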